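import Literature.NumberTheory.GaloisRepresentations.ChebotarevCosetCyclotomic
import Literature.NumberTheory.GaloisRepresentations.IntegralGaloisActionProofs
import Literature.NumberTheory.GaloisRepresentations.SplitsCompletelyCriteria
import Literature.NumberTheory.NumberFields.SplitPrimesBaseChange
import Mathlib.NumberTheory.NumberField.Discriminant.Different
import Mathlib.RingTheory.Flat.TorsionFree
import HarnessLib

/-!
# Decomposed generic primes come in infinite families (Allen et al. 2023, Lemma 4.3.2)

Topic `Literature/NumberTheory/GaloisRepresentations`.  A *proofs* file: theorems only, no named
fact (D-0026), unconditional.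

Allen–Calegari–Caraiani–Gee–Helm–Le Hung–Newton–Scholze–Taylor–Thorne, *Potential automorphy
over CM fields*, Ann. of Math. 197 (2023), Lemma 4.3.2 (arXiv:1812.09999 p. 34, "Lemma 33"):

> Let `L` be a number field, and let `r̄ : G_L → GL_n(k)` be a continuous representation.
> Suppose that `r̄` is decomposed generic. Then there exist infinitely many primes `p₀ ≠ p` which
> are decomposed generic for `r̄`.
> *Proof.* Let `K'/ℚ` denote the Galois closure of the extension of `L(ζ_p)` cut out by `r̄`.
> Let `p₀` be a prime which is decomposed generic for `r̄`; then any other prime `l` which is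
> unramified in `K'` and such that `Frob_l`, `Frob_{p₀}` lie in the same conjugacy class of
> `Gal(K'/ℚ)` is also decomposed generic for `r̄`. There are infinitely many such primes, by the
> Chebotarev density theorem.

This lemma is what the proof of the automorphy lifting theorem Thm. 6.1.1 (loc. cit. §6.5.12,
p. 88) uses to choose the auxiliary prime `p₀` and the set `V₂` of `p₀`-adic places *away from*
`2`, `p` and the ramification of `ρ` and `π` ("There exists a rational prime `p₀ ≠ p` which is
decomposed generic for `ρ̄` … For each `v ∈ V₀ ∪ V₁ ∪ V₂`, `v ∤ 2`, `v ∤ p`, and `ρ` and `π` are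
both unramified at `v`"): the hypothesis of Thm. 6.1.1 only provides ONE decomposed generic prime
(`IsDecomposedGeneric τ := ∃ p, IsDecomposedGenericPrime τ p`, file `DecomposedGeneric`).

## What is proved

In the tree's vocabulary (`absoluteGaloisGroup K`, `HeightOneSpectrum.primesAbove`, Mathlib's
`IsArithFrobAt` / `Ideal.inertia`, `SplitsCompletely`, `IsGenericAt`, `IsDecomposedGenericPrime`):

* `infinite_setOf_splitsCompletely_frobenius_transfer` — **the Chebotarev transfer behind
  Lemma 4.3.2, representation-free.**  Let `τ : Γ_K → H` be a homomorphism with open kernel, `p₀`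
  a prime which splits completely in `K` and above which `τ` is unramified (`τ(I_𝔔) = 1` for all
  `𝔔 ∣ v ∣ p₀`), and `N ≥ 1` with `p₀ ∤ N`.  Then there are infinitely many primes `l` with
  `l ∤ N`, `l ≡ p₀ (mod N)`, `l` completely split in `K`, `τ` unramified above `l`, and such that
  for every place `v ∣ l` of `K` and every arithmetic Frobenius `σ ∈ Γ_K` at a prime `𝔔 ∣ v` of
  `\bar ℤ_K` there are a place `v₀ ∣ p₀`, a prime `𝔔₀ ∣ v₀` and an arithmetic Frobenius `σ₀` at `𝔔₀`
  with `τ(σ) = τ(σ₀)` ("`Frob_l` and `Frob_{p₀}` lie in the same conjugacy class", read through `τ`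
  at every place above `l`).
* `IsDecomposedGeneric.infinite_setOf_isDecomposedGenericPrime` — **Lemma 4.3.2** for
  `τ : Γ_K → GL_n(k)` with open kernel over any field `k` of prime characteristic `ℓ` (ACC+: `k`
  finite of characteristic `p`; the tree's residual representations take values in `𝔽̄_p`):
  `IsDecomposedGeneric τ → {p₀ | IsDecomposedGenericPrime τ p₀}.Infinite` (the previous theorem
  with `N = ℓ`, so that `q_v = l ≡ p₀ = q_{v₀}` in `k`).
* `IsDecomposedGeneric.exists_isDecomposedGenericPrime_forall_not_mem` — the consumer form of the
  `V₂` step: a decomposed generic prime outside any finite set of primes and below no place of any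
  finite set of places (e.g. `{2, p}` and the places where `ρ` or `π` ramifies).

## Proof (as printed, with the finite-level bookkeeping made explicit)

Let `K₁ = K̄^{ker τ}` (finite Galois over `K` as `ker τ` is open), `θ` a primitive element of
`K₁/ℚ`, `ζ ∈ K̄` a primitive `N`-th root of unity and `M ⊆ K̄` the field generated over `K` by the
`K̄`-roots of `f = minpoly_ℚ(θ) · (X^N - 1)`: `M ⊇ K₁(ζ)` is finite Galois over `K` AND over `ℚ`
(a splitting field of `f` over both; the printed `K'`).  Write `r : Γ_K → Gal(M/K) ⊆ G = Gal(M/ℚ)`.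
Fix a place `v₀ ∣ p₀`, a prime `𝔔₀ ∣ v₀` of `\bar ℤ_K` and an arithmetic Frobenius `σ₀ ∈ Γ_K` at `𝔔₀`
(`exists_isArithFrobAt_of_mem_primesAbove_holds`), and put `g₀ = σ₀|_M`, a Frobenius of `M/ℚ` at
`𝔓₀ = 𝔔₀ ∩ M` because `N v₀ = p₀`.  (Choosing the class of an ABSOLUTE Frobenius avoids the
printed "unramified in `K'`" at `p₀`.)  By the tree's degree-one Chebotarev theorem
(`infinite_setOf_prime_absNorm_frobenius_restrict_eq`, for `M/K`) there are infinitely many places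
`v` of `K` of prime norm `l`, unramified in `M`, with an absolute Frobenius `Φ` above `v` such that
`Φ|_M = g₀`; discarding the finitely many `l ∣ N · disc K` we may assume `l ∤ N` and `l`
unramified in `K` (`NumberField.not_dvd_discr_iff_isUnramifiedIn`).  For such `v`, with
`𝔓 = 𝔔 ∩ M` the prime of `M` below the prime of `Φ`:
1. `g₀` is a Frobenius of `M/ℚ` at `𝔓 ∣ l` (as `N v = l`) and at `𝔓₀ ∣ p₀`, so `ζ^l = g₀ ζ = ζ^{p₀}`
   (`AlgHom.IsArithFrobAt.apply_of_pow_eq_one`) and `l ≡ p₀ (mod N)`;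
2. `e(𝔓 | l) = e(v | l) e(𝔓 | v) = 1`, so `l` is unramified in the Galois `M/ℚ`
   (`Ideal.ramificationIdx_tower`, `ramificationIdxIn_eq_ramificationIdx`), hence every place
   `v' ∣ l` of `K` is unramified in `M` and `τ(I_{𝔔'}) = 1` for `𝔔' ∣ v'`
   (`absRestrictNormalHom_eq_one_of_isUnramifiedIn`);
3. every prime `𝔓'` of `M` above `l` is `γ 𝔓` for some `γ ∈ G` (transitivity), with Frobenius
   `γ g₀ γ⁻¹ ∈ Stab_G(γ 𝔓₀)`; since `p₀` splits completely in `K`,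
   `#Stab_G(γ 𝔓₀) = e f = #Stab_{Gal(M/K)}(γ 𝔓₀)` (`Ideal.card_stabilizer_eq` twice and the towers
   `e_ℚ = e(v₀'|p₀) e_K`, `f_ℚ = f(v₀'|p₀) f_K`), so `γ g₀ γ⁻¹ = h|_ℚ` for some `h ∈ Gal(M/K)`: the
   Frobenius of `𝔓'` fixes `K`, whence `f(v'|l) = 1` (`inertiaDeg_eq_one_of_forall_pow_sub_mem'`),
   i.e. `l` splits completely in `K`, and the restriction `σ|_M` of any absolute Frobenius `σ` at
   `𝔔' ∣ 𝔓'` (relative to `K`, `N v' = l`) is THE Frobenius of `𝔓'` (`#I = e = 1`), `σ|_M = h`;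
4. `h` is also a Frobenius of `M/K` at `γ 𝔓₀ ∣ v₀' ∣ p₀`; lifting an absolute Frobenius `σ₁` at a
   prime `𝔔₁ ∣ γ 𝔓₀` of `\bar ℤ_K`, `σ₁|_M` and `h` differ by an element of `I(γ 𝔓₀) ≤ Gal(M/K)`,
   which is the restriction of an absolute inertia element `ι ∈ I_{𝔔₁}` (Serre, *Local Fields* I §7
   Prop. 22 (b), tree `exists_mem_inertia_absRestrictNormalHom_eq`), killed by `τ`; hence
   `τ(σ) = τ(h-lift) = τ(ι σ₁) = τ(σ₁)` with `σ₁` an absolute Frobenius above `p₀`.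

## References

* [ACCGHLNSTT2023] P. B. Allen et al., *Potential automorphy over CM fields*, Ann. of Math. (2)
  197 (2023), 897–1113: Lemma 4.3.2 and Def. 4.3.1 (arXiv:1812.09999 p. 34); §6.5.12, proof of
  Thm. 6.1.1, choice of `p₀` and `V₂` (p. 88).
* [NeukirchANT1999] J. Neukirch, *Algebraic Number Theory* (1999), Ch. I §9 (9.1)–(9.6)
  (decomposition and inertia groups, Frobenius), Ch. VII (13.4) (Chebotarev).
* [SerreLocalFields1979] J.-P. Serre, *Local Fields* (1979), Ch. I §7 Prop. 22 (b).
* [Marcus2018] D. A. Marcus, *Number Fields*, 2nd ed. (2018), Ch. 4, Thm. 28–32.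
-/

noncomputable section

open NumberField IsDedekindDomain IsDedekindDomain.HeightOneSpectrum Field Polynomial
open scoped Pointwise

namespace Literature.NumberTheory.GaloisRepresentations

/-! ## §1. Finite level: a Galois number field `M/ℚ` containing `K` -/

section FiniteLevel

variable {K M : Type*} [Field K] [NumberField K] [Field M] [NumberField M] [Algebra K M]

/-- `#(ℤ ⧸ (l)) = l`. [folklore] -/
theorem natCard_int_quotient_span_natCast (l : ℕ) :
    Nat.card (ℤ ⧸ Ideal.span {(l : ℤ)}) = l := by
  rw [Nat.card_congr (Int.quotientSpanNatEquivZMod l).toEquiv, Nat.card_zmod]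

/-- Restricting scalars from `K` to `ℚ` does not change the Galois action on `𝓞 M`. [folklore] -/
theorem restrictScalars_rat_smul_ringOfIntegers (h : M ≃ₐ[K] M) (x : 𝓞 M) :
    (h.restrictScalars ℚ) • x = h • x :=
  Subtype.ext rfl

/-- **A Frobenius relative to `K` is a Frobenius relative to `ℚ` when `f = 1` below it**: for
`h ∈ Gal(M/K)` and a prime `𝔓` of `M` whose contractions to `𝓞 K` and to `ℤ` have residue rings of
the same size, `h` is an arithmetic Frobenius at `𝔓` for `𝓞 M / 𝓞 K` iff `h|_ℚ` is one for
`𝓞 M / ℤ` (both say `h x ≡ x^q (mod 𝔓)`). [folklore] -/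
theorem isArithFrobAt_restrictScalars_iff [IsGalois K M] {𝔓 : Ideal (𝓞 M)} (h : M ≃ₐ[K] M)
    (hcard : Nat.card (ℤ ⧸ 𝔓.under ℤ) = Nat.card (𝓞 K ⧸ 𝔓.under (𝓞 K))) :
    IsArithFrobAt ℤ (h.restrictScalars ℚ) 𝔓 ↔ IsArithFrobAt (𝓞 K) h 𝔓 := by
  refine forall_congr' fun x => ?_
  rw [MulSemiringAction.toAlgHom_apply, MulSemiringAction.toAlgHom_apply, hcard,
    restrictScalars_rat_smul_ringOfIntegers]

variable [IsGalois ℚ M]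

/-- **At a prime completely split in `K`, the decomposition group over `ℚ` lies in `Gal(M/K)`.**
Let `M/ℚ` be finite Galois containing `K`, `p` a prime which splits completely in `K` and `𝔓` a
prime of `M` above `p`.  Then every `φ ∈ Gal(M/ℚ)` with `φ 𝔓 = 𝔓` fixes `K` pointwise, i.e.
`φ = h|_ℚ` for some `h ∈ Gal(M/K)`: both stabilisers have `e · f` elements
(`Ideal.card_stabilizer_eq`), as `e(𝔓|p) = e(𝔓 ∩ K|p) e(𝔓|𝔓 ∩ K) = e(𝔓|𝔓 ∩ K)` and likewise for
`f` (Neukirch I (9.3)–(9.4): the decomposition field of `𝔓` contains `K`).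
[cite: NeukirchANT1999, Ch. I §9 Prop. (9.3)–(9.4)] -/
theorem exists_restrictScalars_eq_of_mem_stabilizer {p : ℕ} (hp : p.Prime)
    (hK : SplitsCompletely K p) {𝔓 : Ideal (𝓞 M)}
    (h𝔓 : 𝔓 ∈ (Ideal.span {(p : ℤ)}).primesOver (𝓞 M)) {φ : M ≃ₐ[ℚ] M}
    (hφ : φ ∈ MulAction.stabilizer (M ≃ₐ[ℚ] M) 𝔓) :
    ∃ h : M ≃ₐ[K] M, h.restrictScalars ℚ = φ := by
  classical
  haveI := h𝔓.1
  haveI := h𝔓.2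
  haveI : IsGalois K M := IsGalois.tower_top_of_isGalois ℚ K M
  have hp0 : Ideal.span {(p : ℤ)} ≠ ⊥ := by
    rw [ne_eq, Ideal.span_singleton_eq_bot]; exact_mod_cast hp.ne_zero
  haveI hpmax : (Ideal.span {(p : ℤ)}).IsMaximal :=
    ((Ideal.span_singleton_prime (by exact_mod_cast hp.ne_zero)).mpr
      (Nat.prime_iff_prime_int.mp hp)).isMaximal hp0
  -- `P = 𝔓 ∩ 𝓞 K`, a prime of `K` above `p` with `e(P|p) = f(P|p) = 1`
  set P : Ideal (𝓞 K) := 𝔓.under (𝓞 K) with hPdef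
  haveI hPp : P.LiesOver (Ideal.span {(p : ℤ)}) := inferInstance
  have hP : P ∈ (Ideal.span {(p : ℤ)}).primesOver (𝓞 K) := ⟨inferInstance, hPp⟩
  obtain ⟨hunr, hf⟩ := (splitsCompletely_iff_forall_inertiaDeg_eq_one hp).mp hK
  have heP : P.ramificationIdx ℤ = 1 :=
    (Algebra.isUnramifiedIn_iff_forall_ramificationIdx_eq_one.mp hunr) P hPp
  have hfP : P.inertiaDeg ℤ = 1 := hf P hP
  -- the restriction `ι : Gal(M/K) → Gal(M/ℚ)`
  let ι : (M ≃ₐ[K] M) →* (M ≃ₐ[ℚ] M) :=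
    { toFun := fun σ => σ.restrictScalars ℚ
      map_one' := AlgEquiv.ext fun _ => rfl
      map_mul' := fun _ _ => AlgEquiv.ext fun _ => rfl }
  have hιapp : ∀ σ : M ≃ₐ[K] M, ι σ = σ.restrictScalars ℚ := fun _ => rfl
  have hι : Function.Injective ι := AlgEquiv.restrictScalars_injective ℚ
  have hsmulI : ∀ (σ : M ≃ₐ[K] M) (I : Ideal (𝓞 M)), ι σ • I = σ • I := by
    intro σ I
    have hRH : MulSemiringAction.toRingHom (M ≃ₐ[ℚ] M) (𝓞 M) (ι σ) =
        MulSemiringAction.toRingHom (M ≃ₐ[K] M) (𝓞 M) σ :=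
      RingHom.ext fun x => restrictScalars_rat_smul_ringOfIntegers σ x
    rw [Ideal.pointwise_smul_def, Ideal.pointwise_smul_def, hRH]
  -- `Stab_K(𝔓) ↪ Stab_ℚ(𝔓)`
  have hle : (MulAction.stabilizer (M ≃ₐ[K] M) 𝔓).map ι ≤
      MulAction.stabilizer (M ≃ₐ[ℚ] M) 𝔓 := by
    rintro _ ⟨σ, hσ, rfl⟩
    rw [SetLike.mem_coe, MulAction.mem_stabilizer_iff] at hσ
    rw [MulAction.mem_stabilizer_iff, hsmulI, hσ]
  -- both stabilisers have `e f` elements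
  have hcardQ : Nat.card (MulAction.stabilizer (M ≃ₐ[ℚ] M) 𝔓) =
      𝔓.ramificationIdx ℤ * 𝔓.inertiaDeg ℤ := by
    rw [Ideal.card_stabilizer_eq (G := M ≃ₐ[ℚ] M) (Ideal.span {(p : ℤ)}) 𝔓,
      Ideal.ramificationIdxIn_eq_ramificationIdx (Ideal.span {(p : ℤ)}) 𝔓 (M ≃ₐ[ℚ] M),
      Ideal.inertiaDegIn_eq_inertiaDeg (Ideal.span {(p : ℤ)}) 𝔓 (M ≃ₐ[ℚ] M)]
  have hPne : P ≠ ⊥ := Ideal.ne_bot_of_liesOver_of_ne_bot hp0 P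
  haveI : P.IsMaximal := Ideal.IsPrime.isMaximal inferInstance hPne
  have hcardK : Nat.card (MulAction.stabilizer (M ≃ₐ[K] M) 𝔓) =
      𝔓.ramificationIdx (𝓞 K) * 𝔓.inertiaDeg (𝓞 K) := by
    rw [Ideal.card_stabilizer_eq (G := M ≃ₐ[K] M) P 𝔓,
      Ideal.ramificationIdxIn_eq_ramificationIdx P 𝔓 (M ≃ₐ[K] M),
      Ideal.inertiaDegIn_eq_inertiaDeg P 𝔓 (M ≃ₐ[K] M)]
  have htower : 𝔓.ramificationIdx ℤ * 𝔓.inertiaDeg ℤ =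
      𝔓.ramificationIdx (𝓞 K) * 𝔓.inertiaDeg (𝓞 K) := by
    rw [Ideal.ramificationIdx_tower (R := ℤ) P 𝔓, Ideal.inertiaDeg_tower (R := ℤ) P 𝔓, heP, hfP,
      one_mul, one_mul]
  have hge : Nat.card (MulAction.stabilizer (M ≃ₐ[ℚ] M) 𝔓) ≤
      Nat.card ((MulAction.stabilizer (M ≃ₐ[K] M) 𝔓).map ι) := by
    rw [Subgroup.card_map_of_injective hι, hcardK, ← htower, ← hcardQ]
  have heq := Subgroup.eq_of_le_of_card_ge hle hge
  have hmem : φ ∈ (MulAction.stabilizer (M ≃ₐ[K] M) 𝔓).map ι := by rw [heq]; exact hφ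
  obtain ⟨h, -, hh⟩ := hmem
  exact ⟨h, by rw [← hιapp, hh]⟩

omit [IsGalois ℚ M] in
/-- **A Frobenius over `ℚ` fixing `K` forces residue degree one below it**: if `h ∈ Gal(M/K)` is,
after restricting scalars, an arithmetic Frobenius of `M/ℚ` at a prime `𝔓 ∣ l`, then
`y^l ≡ h y = y (mod 𝔓 ∩ 𝓞 K)` for all `y ∈ 𝓞 K`, so `f(𝔓 ∩ K | l) = 1`
(`inertiaDeg_eq_one_of_forall_pow_sub_mem'`; Marcus, *Number Fields*, Ch. 4, Thm. 28–29).
[cite: Marcus2018, Ch. 4, Thm. 29] -/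
theorem inertiaDeg_under_eq_one_of_isArithFrobAt_restrictScalars [IsGalois K M] {l : ℕ}
    (hl : l.Prime) {𝔓 : Ideal (𝓞 M)} (h𝔓 : 𝔓 ∈ (Ideal.span {(l : ℤ)}).primesOver (𝓞 M))
    {h : M ≃ₐ[K] M} (hφ : IsArithFrobAt ℤ (h.restrictScalars ℚ) 𝔓) :
    (𝔓.under (𝓞 K)).inertiaDeg ℤ = 1 := by
  classical
  haveI := h𝔓.1
  haveI := h𝔓.2
  have hl0 : Ideal.span {(l : ℤ)} ≠ ⊥ := by
    rw [ne_eq, Ideal.span_singleton_eq_bot]; exact_mod_cast hl.ne_zero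
  haveI hlmax : (Ideal.span {(l : ℤ)}).IsMaximal :=
    ((Ideal.span_singleton_prime (by exact_mod_cast hl.ne_zero)).mpr
      (Nat.prime_iff_prime_int.mp hl)).isMaximal hl0
  set P : Ideal (𝓞 K) := 𝔓.under (𝓞 K) with hPdef
  haveI hPl : P.LiesOver (Ideal.span {(l : ℤ)}) := inferInstance
  have hPne : P ≠ ⊥ := Ideal.ne_bot_of_liesOver_of_ne_bot hl0 P
  haveI : P.IsMaximal := Ideal.IsPrime.isMaximal inferInstance hPne
  haveI : Finite (ℤ ⧸ Ideal.span {(l : ℤ)}) := by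
    apply Nat.finite_of_card_ne_zero
    rw [natCard_int_quotient_span_natCast]
    exact hl.ne_zero
  have hq : 1 < Nat.card (ℤ ⧸ Ideal.span {(l : ℤ)}) := by
    rw [natCard_int_quotient_span_natCast]; exact hl.one_lt
  refine inertiaDeg_eq_one_of_forall_pow_sub_mem' (Ideal.span {(l : ℤ)}) P hq fun y => ?_
  -- `y ^ l - y ∈ 𝔓 ∩ 𝓞 K` because `h` fixes `y` and `h y ≡ y ^ l (mod 𝔓)`
  rw [hPdef, Ideal.under_def, Ideal.mem_comap, map_sub, map_pow]
  have h1 := hφ (algebraMap (𝓞 K) (𝓞 M) y)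
  rw [← h𝔓.2.over, MulSemiringAction.toAlgHom_apply, restrictScalars_rat_smul_ringOfIntegers]
    at h1
  have hfix : h • algebraMap (𝓞 K) (𝓞 M) y = algebraMap (𝓞 K) (𝓞 M) y := by
    apply Subtype.ext
    change h (algebraMap K M (y : K)) = algebraMap K M (y : K)
    exact h.commutes _
  rw [hfix] at h1
  rw [← Ideal.neg_mem_iff, neg_sub]
  exact h1

omit [NumberField K] [Algebra K M] in
/-- **In a Galois `M/ℚ`, one prime above `l` with `e = 1` makes `l` unramified in `M`** (all
ramification indices above `l` coincide, `Ideal.ramificationIdxIn_eq_ramificationIdx`).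
Neukirch I (9.1)–(9.2). [cite: NeukirchANT1999, Ch. I §9 Prop. (9.1)] -/
theorem isUnramifiedIn_span_of_ramificationIdx_eq_one {l : ℕ} {𝔓 : Ideal (𝓞 M)}
    (h𝔓 : 𝔓 ∈ (Ideal.span {(l : ℤ)}).primesOver (𝓞 M)) (he : 𝔓.ramificationIdx ℤ = 1) :
    Algebra.IsUnramifiedIn (𝓞 M) (Ideal.span {(l : ℤ)}) := by
  haveI := h𝔓.1
  haveI := h𝔓.2
  rw [Algebra.isUnramifiedIn_iff_forall_ramificationIdx_eq_one]
  intro Q _ hQ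
  rw [← Ideal.ramificationIdxIn_eq_ramificationIdx (Ideal.span {(l : ℤ)}) Q (M ≃ₐ[ℚ] M),
    Ideal.ramificationIdxIn_eq_ramificationIdx (Ideal.span {(l : ℤ)}) 𝔓 (M ≃ₐ[ℚ] M)]
  exact he

omit [IsGalois ℚ M] in
/-- **Unramifiedness of `l` in `M` forces unramifiedness of every `v ∣ l` of `K` in `M/K`**
(`e(𝔓|l) = e(v|l) e(𝔓|v)`, Mathlib `Ideal.ramificationIdx_tower`). Neukirch II (8.5) /
transitivity of `e`. [folklore] -/
theorem isUnramifiedIn_of_isUnramifiedIn_span {l : ℕ} (hl : l.Prime)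
    (hM : Algebra.IsUnramifiedIn (𝓞 M) (Ideal.span {(l : ℤ)}))
    (v : HeightOneSpectrum (𝓞 K)) (hv : ((l : ℕ) : 𝓞 K) ∈ v.asIdeal) :
    Algebra.IsUnramifiedIn (𝓞 M) v.asIdeal := by
  haveI := v.isPrime
  haveI := liesOver_span_of_natCast_mem_asIdeal hl v hv
  rw [Algebra.isUnramifiedIn_iff_forall_ramificationIdx_eq_one]
  intro Q _ hQ
  haveI := hQ
  haveI : Q.LiesOver (Ideal.span {(l : ℤ)}) := Ideal.LiesOver.trans Q v.asIdeal _
  have h1 := (Algebra.isUnramifiedIn_iff_forall_ramificationIdx_eq_one.mp hM) Q ‹_›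
  rw [Ideal.ramificationIdx_tower (R := ℤ) v.asIdeal Q] at h1
  exact Nat.eq_one_of_mul_eq_one_left h1

end FiniteLevel

/-! ## §2. Roots of unity under Frobenius elements of `Gal(M/ℚ)` -/

section Cyclotomic

variable {M : Type*} [Field M] [NumberField M]

omit [NumberField M] in
/-- **A Frobenius at a prime above `l ∤ N` raises `N`-th roots of unity to the `l`-th power**
(Mathlib `AlgHom.IsArithFrobAt.apply_of_pow_eq_one` on `𝓞 M`). Neukirch I (10.3).
[cite: NeukirchANT1999, Ch. I §10 (10.3)] -/
theorem smul_eq_pow_of_isArithFrobAt_int {G : Type*} [Group G] [MulSemiringAction G M]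
    {l N : ℕ} (hlN : ¬ l ∣ N) {𝔓 : Ideal (𝓞 M)}
    (h𝔓 : 𝔓 ∈ (Ideal.span {(l : ℤ)}).primesOver (𝓞 M)) {φ : G} (hφ : IsArithFrobAt ℤ φ 𝔓)
    {ζ : 𝓞 M} (hζ : ζ ^ N = 1) : φ • ζ = ζ ^ l := by
  haveI := h𝔓.1
  haveI := h𝔓.2
  have hN𝔓 : ((N : ℕ) : 𝓞 M) ∉ 𝔓 := by
    intro hmem
    apply hlN
    have h1 : ((N : ℕ) : ℤ) ∈ 𝔓.under ℤ := by
      rw [Ideal.under_def, Ideal.mem_comap, map_natCast]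
      exact hmem
    rw [← h𝔓.2.over, Ideal.mem_span_singleton] at h1
    exact_mod_cast h1
  have h := AlgHom.IsArithFrobAt.apply_of_pow_eq_one hφ hζ hN𝔓
  rw [MulSemiringAction.toAlgHom_apply, ← h𝔓.2.over, natCard_int_quotient_span_natCast] at h
  exact h

omit [NumberField M] in
/-- `ζ^a = ζ^b` for a primitive `N`-th root of unity `ζ` means `a ≡ b (mod N)`. [folklore] -/
theorem modEq_of_pow_eq_pow {N : ℕ} (hN : 0 < N) {ζ : 𝓞 M} (hζ : IsPrimitiveRoot ζ N) {a b : ℕ}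
    (h : ζ ^ a = ζ ^ b) : a ≡ b [MOD N] := by
  set u : (𝓞 M)ˣ := (hζ.isUnit hN.ne').unit with hu
  have hu' : IsPrimitiveRoot u N := IsPrimitiveRoot.coe_units_iff.mp (by
    rw [hu, IsUnit.unit_spec]; exact hζ)
  have hpow : u ^ a = u ^ b := by
    apply Units.ext
    rw [Units.val_pow_eq_pow_val, Units.val_pow_eq_pow_val, hu, IsUnit.unit_spec]
    exact h
  rw [pow_eq_pow_iff_modEq, ← hu'.eq_orderOf] at hpow
  exact hpow

end Cyclotomic

/-! ## §3. Absolute Frobenius and inertia elements of `Γ_K` versus `Gal(M/K)` for `M ⊆ K̄` -/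

section Absolute

variable {K : Type} [Field K] [NumberField K]
  (M : IntermediateField K (AlgebraicClosure K)) [FiniteDimensional K M] [IsGalois K M]
  [NumberField M]

omit [NumberField K] [NumberField M] in
/-- **Inertia surjects onto inertia** in the `𝓞 M`-currency: every element of the inertia group of
`𝔔 ∩ 𝓞 M` in `Gal(M/K)` is the restriction of an element of the absolute inertia group `I_𝔔 ≤ Γ_K`
(Serre, *Local Fields*, I §7 Prop. 22 (b); tree `exists_mem_inertia_absRestrictNormalHom_eq`,
stated there for `integralClosure (𝓞 K) M`). [cite: SerreLocalFields1979, Ch. I §7 Prop. 22(b)] -/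
theorem exists_mem_inertia_absRestrictNormalHom_eq_of_comap {𝔔 : Ideal (absIntegers (𝓞 K) K)}
    [𝔔.IsPrime] {g : M ≃ₐ[K] M}
    (hg : g ∈ (𝔔.comap (EllipticCurves.ringOfIntegersToIntegralClosure (k := K)
      (Ω := AlgebraicClosure K) M)).inertia (M ≃ₐ[K] M)) :
    ∃ σ ∈ 𝔔.inertia (absoluteGaloisGroup K), absRestrictNormalHom M σ = g := by
  set ι := EllipticCurves.ringOfIntegersToIntegralClosure (k := K) (Ω := AlgebraicClosure K) M
    with hιdef
  have hg' : g ∈ (𝔔.comap (M.integralClosureToAbsIntegers (𝓞 K))).inertia (M ≃ₐ[K] M) := by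
    haveI : @IsScalarTower ℤ (𝓞 K) M Algebra.toSMul Algebra.toSMul Algebra.toSMul :=
      IsScalarTower.of_algebraMap_eq' (RingHom.ext_int _ _)
    intro x
    have hxint : IsIntegral ℤ (x : M) := isIntegral_trans (R := ℤ) (A := 𝓞 K) (x : M) x.2
    set y : 𝓞 M := ⟨(x : M), hxint⟩ with hydef
    have hy : g • y - y ∈ 𝔔.comap ι := hg y
    rw [Ideal.mem_comap] at hy
    change M.integralClosureToAbsIntegers (𝓞 K) (g • x - x) ∈ 𝔔
    have heq : M.integralClosureToAbsIntegers (𝓞 K) (g • x - x) = ι (g • y - y) := by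
      apply Subtype.ext
      rw [map_sub, map_sub]
      change ((M.integralClosureToAbsIntegers (𝓞 K) (g • x) : absIntegers (𝓞 K) K) :
          AlgebraicClosure K) - (M.integralClosureToAbsIntegers (𝓞 K) x : AlgebraicClosure K) =
        ((ι (g • y) : absIntegers (𝓞 K) K) : AlgebraicClosure K) - (ι y : AlgebraicClosure K)
      rw [IntermediateField.coe_integralClosureInclusion,
        IntermediateField.coe_integralClosureInclusion,
        EllipticCurves.coe_ringOfIntegersToIntegralClosure,
        EllipticCurves.coe_ringOfIntegersToIntegralClosure, integralClosure.coe_smul,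
        RingOfIntegers.coe_galois_smul]
      rfl
    rw [heq]
    exact hy
  exact exists_mem_inertia_absRestrictNormalHom_eq 𝔔 M hg'

/-- **Transfer of Frobenius values through `Gal(M/K)`.**  Let `τ : Γ_K → H` kill `Gal(K̄/M)`
(`σ|_M = 1 → τ σ = 1`) and every absolute inertia group above the place `v` of `K`.  If
`h ∈ Gal(M/K)` is an arithmetic Frobenius at a prime `𝔓 ∣ v` of `M` and `σ ∈ Γ_K` restricts to
`h`, then `τ(σ) = τ(σ₁)` for some absolute arithmetic Frobenius `σ₁` at some prime `𝔔₁ ∣ v` of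
`\bar ℤ_K`: lift `𝔓` to `𝔔₁` and take any Frobenius `σ₁` there
(`exists_isArithFrobAt_of_mem_primesAbove_holds`); `σ₁|_M` is a Frobenius at `𝔓`
(`isArithFrobAt_absRestrictNormalHom`), so `h = i · σ₁|_M` with `i ∈ I(𝔓)`
(`IsArithFrobAt.mul_inv_mem_inertia`), and `i` lifts to absolute inertia, killed by `τ`.
Neukirch I (9.4)–(9.5). [cite: NeukirchANT1999, Ch. I §9 (9.4)–(9.5)]
[cite: SerreLocalFields1979, Ch. I §7 Prop. 22(b)] -/
theorem exists_isArithFrobAt_apply_eq_of_absRestrictNormalHom_eq {H : Type*} [Group H]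
    (τ : absoluteGaloisGroup K →* H) (hker : ∀ γ, absRestrictNormalHom M γ = 1 → τ γ = 1)
    {v : HeightOneSpectrum (𝓞 K)}
    (hunr : ∀ 𝔔 ∈ v.primesAbove, ∀ g ∈ 𝔔.inertia (absoluteGaloisGroup K), τ g = 1)
    {𝔓 : Ideal (𝓞 M)} (h𝔓 : 𝔓 ∈ v.asIdeal.primesOver (𝓞 M)) {h : M ≃ₐ[K] M}
    (hh : IsArithFrobAt (𝓞 K) h 𝔓) {σ : absoluteGaloisGroup K} (hσ : absRestrictNormalHom M σ = h) :
    ∃ 𝔔₁ ∈ v.primesAbove, ∃ σ₁ : absoluteGaloisGroup K, IsArithFrobAt (𝓞 K) σ₁ 𝔔₁ ∧ τ σ = τ σ₁ := by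
  classical
  haveI := h𝔓.1
  haveI := h𝔓.2
  set ι := EllipticCurves.ringOfIntegersToIntegralClosure (k := K) (Ω := AlgebraicClosure K) M
    with hιdef
  have hιalg : ∀ x : 𝓞 K, ι (algebraMap (𝓞 K) (𝓞 M) x) =
      algebraMap (𝓞 K) (absIntegers (𝓞 K) K) x := fun x => rfl
  -- lift `𝔓` to a prime `𝔔₁` of `\bar ℤ_K`
  obtain ⟨𝔔₁, h𝔔₁prime, h𝔔₁𝔓⟩ : ∃ 𝔔₁ : Ideal (absIntegers (𝓞 K) K), 𝔔₁.IsPrime ∧ 𝔔₁.comap ι = 𝔓 := by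
    letI : Algebra (𝓞 M) (absIntegers (𝓞 K) K) := ι.toAlgebra
    haveI : IsScalarTower (𝓞 K) (𝓞 M) (absIntegers (𝓞 K) K) :=
      IsScalarTower.of_algebraMap_eq fun x => (hιalg x).symm
    haveI : Algebra.IsIntegral (𝓞 M) (absIntegers (𝓞 K) K) :=
      ⟨fun x => (Algebra.IsIntegral.isIntegral (R := 𝓞 K) x).tower_top⟩
    obtain ⟨𝔔₁, -, h𝔔₁prime, h𝔔₁𝔓⟩ := Ideal.exists_ideal_over_prime_of_isIntegral 𝔓
      (⊥ : Ideal (absIntegers (𝓞 K) K))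
      (fun x hx => by
        rw [Ideal.mem_comap, Ideal.mem_bot] at hx
        have hx0 : x = 0 :=
          EllipticCurves.ringOfIntegersToIntegralClosure_injective M (hx.trans (map_zero _).symm)
        rw [hx0]
        exact 𝔓.zero_mem)
    exact ⟨𝔔₁, h𝔔₁prime, h𝔔₁𝔓⟩
  haveI := h𝔔₁prime
  have h𝔔₁v : 𝔔₁ ∈ v.primesAbove := by
    refine ⟨h𝔔₁prime, ⟨?_⟩⟩
    rw [h𝔓.2.over, ← h𝔔₁𝔓]
    ext x
    simp only [Ideal.under, Ideal.mem_comap]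
    exact Iff.of_eq (congrArg (· ∈ 𝔔₁) (hιalg x))
  -- an absolute Frobenius `σ₁` at `𝔔₁`; its restriction is a Frobenius at `𝔓`
  obtain ⟨σ₁, hσ₁⟩ := exists_isArithFrobAt_of_mem_primesAbove_holds h𝔔₁v
  have hrσ₁ : IsArithFrobAt (𝓞 K) (absRestrictNormalHom M σ₁) 𝔓 := by
    have h1 := isArithFrobAt_absRestrictNormalHom M hσ₁
    rwa [h𝔔₁𝔓] at h1
  -- `h (σ₁|_M)⁻¹ ∈ I(𝔓)` lifts to an absolute inertia element `g` at `𝔔₁`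
  have hi : h * (absRestrictNormalHom M σ₁)⁻¹ ∈ (𝔔₁.comap ι).inertia (M ≃ₐ[K] M) := by
    rw [h𝔔₁𝔓]
    exact hh.mul_inv_mem_inertia hrσ₁
  obtain ⟨g, hgI, hg⟩ := exists_mem_inertia_absRestrictNormalHom_eq_of_comap M hi
  refine ⟨𝔔₁, h𝔔₁v, σ₁, hσ₁, ?_⟩
  -- `σ|_M = (g σ₁)|_M`, so `τ σ = τ (g σ₁) = τ σ₁`
  have hres : absRestrictNormalHom M (σ * (g * σ₁)⁻¹) = 1 := by
    rw [map_mul, map_inv, map_mul, hg, hσ, inv_mul_cancel_right, mul_inv_cancel]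
  have h1 := hker _ hres
  rw [map_mul, map_inv, mul_inv_eq_one] at h1
  rw [h1, map_mul, hunr 𝔔₁ h𝔔₁v g hgI, one_mul]

end Absolute

/-! ## §4. The transfer at a Chebotarev place -/

section KeyStep

variable {K : Type} [Field K] [NumberField K]
  (M : IntermediateField K (AlgebraicClosure K)) [FiniteDimensional K M] [IsGalois K M]
  [NumberField M] [IsGalois ℚ M]

/-- **The key step** (items 1–4 of the module docstring).  Data: `M ⊆ K̄` finite Galois over `K`
and over `ℚ`, `τ : Γ_K → H` killing `Gal(K̄/M)`, a prime `p₀` completely split in `K` above which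
`τ` is unramified, a primitive `N`-th root of unity `ζ ∈ 𝓞 M` with `p₀ ∤ N`, an absolute
Frobenius `σ₀` at `𝔔₀ ∣ v₀ ∣ p₀`, and a place `v` of `K` of prime norm `l ∤ N` with `l` unramified
in `K`, `v` unramified in `M`, carrying an absolute Frobenius `Φ` at `𝔔 ∣ v` with `Φ|_M = σ₀|_M`
(the output of Chebotarev).  Conclusion: `l ≡ p₀ (mod N)`, `l` splits completely in `K`, `τ` is
unramified above `l`, and every Frobenius value of `τ` above `l` is a Frobenius value above `p₀`.
[cite: ACCGHLNSTT2023, Lemma 4.3.2 (proof)] -/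
theorem modEq_and_splitsCompletely_and_frobenius_transfer {H : Type*} [Group H]
    (τ : absoluteGaloisGroup K →* H) (hker : ∀ γ, absRestrictNormalHom M γ = 1 → τ γ = 1)
    {p₀ : ℕ} (hp₀ : p₀.Prime) (hsplit : SplitsCompletely K p₀)
    (hunr₀ : ∀ v : HeightOneSpectrum (𝓞 K), ((p₀ : ℕ) : 𝓞 K) ∈ v.asIdeal →
      ∀ 𝔔 ∈ v.primesAbove, ∀ g ∈ 𝔔.inertia (absoluteGaloisGroup K), τ g = 1)
    {N : ℕ} (hN : 0 < N) (hpN : ¬ p₀ ∣ N) {ζ : 𝓞 M} (hζ : IsPrimitiveRoot ζ N)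
    {v₀ : HeightOneSpectrum (𝓞 K)} (hv₀ : ((p₀ : ℕ) : 𝓞 K) ∈ v₀.asIdeal)
    {𝔔₀ : Ideal (absIntegers (𝓞 K) K)} (h𝔔₀ : 𝔔₀ ∈ v₀.primesAbove)
    {σ₀ : absoluteGaloisGroup K} (hσ₀ : IsArithFrobAt (𝓞 K) σ₀ 𝔔₀)
    {l : ℕ} (hl : l.Prime) (hlN : ¬ l ∣ N)
    (hunrK : Algebra.IsUnramifiedIn (𝓞 K) (Ideal.span {(l : ℤ)}))
    {v : HeightOneSpectrum (𝓞 K)} (hvl : Ideal.absNorm v.asIdeal = l)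
    (hunrv : Algebra.IsUnramifiedIn (𝓞 M) v.asIdeal)
    {𝔔 : Ideal (absIntegers (𝓞 K) K)} (h𝔔 : 𝔔 ∈ v.primesAbove)
    {Φ : absoluteGaloisGroup K} (hΦ : IsArithFrobAt (𝓞 K) Φ 𝔔)
    (hΦσ₀ : absRestrictNormalHom M Φ = absRestrictNormalHom M σ₀) :
    l ≡ p₀ [MOD N] ∧ SplitsCompletely K l ∧
      ∀ v' : HeightOneSpectrum (𝓞 K), ((l : ℕ) : 𝓞 K) ∈ v'.asIdeal →
        (∀ 𝔔' ∈ v'.primesAbove, ∀ g ∈ 𝔔'.inertia (absoluteGaloisGroup K), τ g = 1) ∧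
        ∀ 𝔔' ∈ v'.primesAbove, ∀ σ : absoluteGaloisGroup K, IsArithFrobAt (𝓞 K) σ 𝔔' →
          ∃ v₁ : HeightOneSpectrum (𝓞 K), ((p₀ : ℕ) : 𝓞 K) ∈ v₁.asIdeal ∧
            ∃ 𝔔₁ ∈ v₁.primesAbove, ∃ σ₁ : absoluteGaloisGroup K,
              IsArithFrobAt (𝓞 K) σ₁ 𝔔₁ ∧ τ σ = τ σ₁ := by
  classical
  set r : absoluteGaloisGroup K →* (M ≃ₐ[K] M) := absRestrictNormalHom M with hrdef
  set ιM := EllipticCurves.ringOfIntegersToIntegralClosure (k := K) (Ω := AlgebraicClosure K) M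
    with hιMdef
  -- the primes `(p₀)` and `(l)` of `ℤ`
  have hp0 : Ideal.span {(p₀ : ℤ)} ≠ ⊥ := by
    rw [ne_eq, Ideal.span_singleton_eq_bot]; exact_mod_cast hp₀.ne_zero
  haveI hp0max : (Ideal.span {(p₀ : ℤ)}).IsMaximal :=
    ((Ideal.span_singleton_prime (by exact_mod_cast hp₀.ne_zero)).mpr
      (Nat.prime_iff_prime_int.mp hp₀)).isMaximal hp0
  have hl0 : Ideal.span {(l : ℤ)} ≠ ⊥ := by
    rw [ne_eq, Ideal.span_singleton_eq_bot]; exact_mod_cast hl.ne_zero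
  haveI hl0max : (Ideal.span {(l : ℤ)}).IsMaximal :=
    ((Ideal.span_singleton_prime (by exact_mod_cast hl.ne_zero)).mpr
      (Nat.prime_iff_prime_int.mp hl)).isMaximal hl0
  -- `𝔓₀ = 𝔔₀ ∩ M`, a prime of `M` above `v₀` and above `p₀`
  haveI := h𝔔₀.1
  set 𝔓₀ : Ideal (𝓞 M) := 𝔔₀.comap ιM with h𝔓₀def
  have h𝔓₀v₀ : 𝔓₀ ∈ v₀.asIdeal.primesOver (𝓞 M) :=
    comap_ringOfIntegersToIntegralClosure_mem_primesOver_of_mem_primesAbove M h𝔔₀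
  haveI := h𝔓₀v₀.1
  haveI := h𝔓₀v₀.2
  haveI : v₀.asIdeal.LiesOver (Ideal.span {(p₀ : ℤ)}) :=
    liesOver_span_of_natCast_mem_asIdeal hp₀ v₀ hv₀
  haveI h𝔓₀p₀ : 𝔓₀.LiesOver (Ideal.span {(p₀ : ℤ)}) := Ideal.LiesOver.trans 𝔓₀ v₀.asIdeal _
  have h𝔓₀mem : 𝔓₀ ∈ (Ideal.span {(p₀ : ℤ)}).primesOver (𝓞 M) := ⟨inferInstance, inferInstance⟩
  -- `g₀ = σ₀|_M`, a Frobenius at `𝔓₀` relative to `K`, and relative to `ℚ` since `N v₀ = p₀`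
  set g₀ : M ≃ₐ[K] M := r σ₀ with hg₀def
  have hg₀K : IsArithFrobAt (𝓞 K) g₀ 𝔓₀ := isArithFrobAt_absRestrictNormalHom M hσ₀
  have hcard₀ : Nat.card (ℤ ⧸ 𝔓₀.under ℤ) = Nat.card (𝓞 K ⧸ 𝔓₀.under (𝓞 K)) := by
    rw [← h𝔓₀p₀.over, natCard_int_quotient_span_natCast, ← h𝔓₀v₀.2.over,
      ← residueCard_eq_card_quotient, hsplit.2 v₀ hv₀]
  have hg₀Z : IsArithFrobAt ℤ (g₀.restrictScalars ℚ) 𝔓₀ :=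
    (isArithFrobAt_restrictScalars_iff g₀ hcard₀).mpr hg₀K
  -- `𝔓 = 𝔔 ∩ M`, a prime of `M` above `v` and above `l`
  haveI := h𝔔.1
  set 𝔓 : Ideal (𝓞 M) := 𝔔.comap ιM with h𝔓def
  have h𝔓v : 𝔓 ∈ v.asIdeal.primesOver (𝓞 M) :=
    comap_ringOfIntegersToIntegralClosure_mem_primesOver_of_mem_primesAbove M h𝔔
  haveI := h𝔓v.1
  haveI := h𝔓v.2
  have hvl' : ((l : ℕ) : 𝓞 K) ∈ v.asIdeal := by
    rw [← hvl]; exact Ideal.absNorm_mem v.asIdeal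
  haveI : v.asIdeal.LiesOver (Ideal.span {(l : ℤ)}) := liesOver_span_of_natCast_mem_asIdeal hl v hvl'
  haveI h𝔓l : 𝔓.LiesOver (Ideal.span {(l : ℤ)}) := Ideal.LiesOver.trans 𝔓 v.asIdeal _
  have h𝔓mem : 𝔓 ∈ (Ideal.span {(l : ℤ)}).primesOver (𝓞 M) := ⟨inferInstance, inferInstance⟩
  -- `g₀ = Φ|_M` is a Frobenius at `𝔓` relative to `K`, and relative to `ℚ` since `N v = l`
  have hg₀K' : IsArithFrobAt (𝓞 K) g₀ 𝔓 := by
    have h1 := isArithFrobAt_absRestrictNormalHom M hΦ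
    rw [hΦσ₀] at h1
    exact h1
  have hcard : Nat.card (ℤ ⧸ 𝔓.under ℤ) = Nat.card (𝓞 K ⧸ 𝔓.under (𝓞 K)) := by
    rw [← h𝔓l.over, natCard_int_quotient_span_natCast, ← h𝔓v.2.over,
      ← residueCard_eq_card_quotient]
    exact hvl.symm
  have hg₀Z' : IsArithFrobAt ℤ (g₀.restrictScalars ℚ) 𝔓 :=
    (isArithFrobAt_restrictScalars_iff g₀ hcard).mpr hg₀K'
  -- (1) `ζ ^ l = g₀ ζ = ζ ^ p₀`, so `l ≡ p₀ (mod N)`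
  have hmod : l ≡ p₀ [MOD N] := by
    have h1 := smul_eq_pow_of_isArithFrobAt_int hlN h𝔓mem hg₀Z' hζ.pow_eq_one
    have h2 := smul_eq_pow_of_isArithFrobAt_int hpN h𝔓₀mem hg₀Z hζ.pow_eq_one
    exact modEq_of_pow_eq_pow hN hζ (h1.symm.trans h2)
  -- (2) `e(𝔓 | l) = e(v | l) e(𝔓 | v) = 1`: `l` is unramified in `M`
  have he𝔓 : 𝔓.ramificationIdx ℤ = 1 := by
    have h1 : v.asIdeal.ramificationIdx ℤ = 1 :=
      (Algebra.isUnramifiedIn_iff_forall_ramificationIdx_eq_one.mp hunrK) v.asIdeal ‹_›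
    have h2 : 𝔓.ramificationIdx (𝓞 K) = 1 :=
      (Algebra.isUnramifiedIn_iff_forall_ramificationIdx_eq_one.mp hunrv) 𝔓 h𝔓v.2
    rw [Ideal.ramificationIdx_tower (R := ℤ) v.asIdeal 𝔓, h1, h2]
  have hunrM : Algebra.IsUnramifiedIn (𝓞 M) (Ideal.span {(l : ℤ)}) :=
    isUnramifiedIn_span_of_ramificationIdx_eq_one h𝔓mem he𝔓
  -- (3) every prime `𝔓'` of `M` above `l` is `γ 𝔓`; its Frobenius `γ g₀ γ⁻¹` stabilises the prime
  -- `γ 𝔓₀` above the completely split `p₀`, hence comes from `Gal(M/K)`, and is a Frobenius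
  -- relative to `K` above `p₀` as well
  have key : ∀ 𝔓' ∈ (Ideal.span {(l : ℤ)}).primesOver (𝓞 M), ∃ h' : M ≃ₐ[K] M,
      IsArithFrobAt ℤ (h'.restrictScalars ℚ) 𝔓' ∧
        ∃ v₁ : HeightOneSpectrum (𝓞 K), ((p₀ : ℕ) : 𝓞 K) ∈ v₁.asIdeal ∧
          ∃ 𝔓₁ ∈ v₁.asIdeal.primesOver (𝓞 M), IsArithFrobAt (𝓞 K) h' 𝔓₁ := by
    intro 𝔓' h𝔓'
    haveI := h𝔓'.1
    haveI := h𝔓'.2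
    obtain ⟨γ, hγ⟩ :=
      Ideal.exists_smul_eq_of_isGaloisGroup (Ideal.span {(l : ℤ)}) 𝔓 𝔓' (M ≃ₐ[ℚ] M)
    have hφ'l : IsArithFrobAt ℤ (γ * g₀.restrictScalars ℚ * γ⁻¹) 𝔓' := by
      rw [← hγ]; exact hg₀Z'.conj γ
    have hφ'p : IsArithFrobAt ℤ (γ * g₀.restrictScalars ℚ * γ⁻¹) (γ • 𝔓₀) := hg₀Z.conj γ
    haveI : (γ • 𝔓₀).IsPrime := Ideal.IsPrime.smul γ
    haveI hγp₀ : (γ • 𝔓₀).LiesOver (Ideal.span {(p₀ : ℤ)}) :=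
      ⟨by rw [Ideal.under_smul]; exact h𝔓₀p₀.over⟩
    have hγ𝔓₀ : γ • 𝔓₀ ∈ (Ideal.span {(p₀ : ℤ)}).primesOver (𝓞 M) :=
      ⟨inferInstance, inferInstance⟩
    have hstab : γ * g₀.restrictScalars ℚ * γ⁻¹ ∈ MulAction.stabilizer (M ≃ₐ[ℚ] M) (γ • 𝔓₀) :=
      hφ'p.mem_stabilizer
    obtain ⟨h', hh'⟩ := exists_restrictScalars_eq_of_mem_stabilizer hp₀ hsplit hγ𝔓₀ hstab
    refine ⟨h', by rw [hh']; exact hφ'l, ?_⟩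
    -- the place `v₁` of `K` below `γ 𝔓₀`
    set P₁ : Ideal (𝓞 K) := (γ • 𝔓₀).under (𝓞 K) with hP₁def
    haveI hP₁p₀ : P₁.LiesOver (Ideal.span {(p₀ : ℤ)}) := inferInstance
    have hP₁ne : P₁ ≠ ⊥ := Ideal.ne_bot_of_liesOver_of_ne_bot hp0 P₁
    set v₁ : HeightOneSpectrum (𝓞 K) := ⟨P₁, Ideal.IsPrime.under (𝓞 K) (γ • 𝔓₀), hP₁ne⟩
      with hv₁def
    have hv₁ : ((p₀ : ℕ) : 𝓞 K) ∈ v₁.asIdeal := natCast_mem_of_liesOver_span hP₁p₀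
    have h𝔓₁ : γ • 𝔓₀ ∈ v₁.asIdeal.primesOver (𝓞 M) := ⟨inferInstance, ⟨rfl⟩⟩
    have hcard₁ : Nat.card (ℤ ⧸ (γ • 𝔓₀).under ℤ) = Nat.card (𝓞 K ⧸ (γ • 𝔓₀).under (𝓞 K)) := by
      rw [← hγp₀.over, natCard_int_quotient_span_natCast]
      change p₀ = Nat.card (𝓞 K ⧸ v₁.asIdeal)
      rw [← residueCard_eq_card_quotient, hsplit.2 v₁ hv₁]
    refine ⟨v₁, hv₁, γ • 𝔓₀, h𝔓₁, (isArithFrobAt_restrictScalars_iff h' hcard₁).mp ?_⟩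
    rw [hh']
    exact hφ'p
  -- residue degree one at every place of `K` above `l`
  have hres : ∀ v' : HeightOneSpectrum (𝓞 K), ((l : ℕ) : 𝓞 K) ∈ v'.asIdeal →
      ∀ 𝔔' ∈ v'.primesAbove, Nat.card (𝓞 K ⧸ v'.asIdeal) = l := by
    intro v' hv' 𝔔' h𝔔'
    haveI := h𝔔'.1
    have h𝔓'v' := comap_ringOfIntegersToIntegralClosure_mem_primesOver_of_mem_primesAbove M h𝔔'
    haveI := h𝔓'v'.1
    haveI := h𝔓'v'.2
    haveI : v'.asIdeal.LiesOver (Ideal.span {(l : ℤ)}) :=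
      liesOver_span_of_natCast_mem_asIdeal hl v' hv'
    haveI : (𝔔'.comap ιM).LiesOver (Ideal.span {(l : ℤ)}) :=
      Ideal.LiesOver.trans (𝔔'.comap ιM) v'.asIdeal _
    obtain ⟨h', hh'l, -⟩ := key (𝔔'.comap ιM) ⟨inferInstance, inferInstance⟩
    have hf := inertiaDeg_under_eq_one_of_isArithFrobAt_restrictScalars hl
      ⟨inferInstance, inferInstance⟩ hh'l
    rw [← h𝔓'v'.2.over] at hf
    haveI := v'.isPrime
    have hpow := Ideal.pow_inertiaDeg l v'.asIdeal
    rw [hf, pow_one, Ideal.absNorm_apply, Submodule.cardQuot_apply] at hpow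
    exact hpow.symm
  refine ⟨hmod, ⟨hunrK, fun v' hv' => ?_⟩, fun v' hv' => ⟨fun 𝔔' h𝔔' g hg => ?_, ?_⟩⟩
  · -- `N v' = l`
    obtain ⟨𝔔', h𝔔'⟩ := primesAbove_nonempty v'
    rw [residueCard_eq_card_quotient]
    exact hres v' hv' 𝔔' h𝔔'
  · -- inertia above `v'` dies in `Gal(M/K)`, hence under `τ`
    exact hker g (absRestrictNormalHom_eq_one_of_isUnramifiedIn M
      (isUnramifiedIn_of_isUnramifiedIn_span hl hunrM v' hv') h𝔔' hg)
  · -- Frobenius transfer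
    intro 𝔔' h𝔔' σ hσ
    haveI := h𝔔'.1
    have h𝔓'v' := comap_ringOfIntegersToIntegralClosure_mem_primesOver_of_mem_primesAbove M h𝔔'
    haveI := h𝔓'v'.1
    haveI := h𝔓'v'.2
    haveI : v'.asIdeal.LiesOver (Ideal.span {(l : ℤ)}) :=
      liesOver_span_of_natCast_mem_asIdeal hl v' hv'
    haveI : (𝔔'.comap ιM).LiesOver (Ideal.span {(l : ℤ)}) :=
      Ideal.LiesOver.trans (𝔔'.comap ιM) v'.asIdeal _
    have h𝔓'mem : 𝔔'.comap ιM ∈ (Ideal.span {(l : ℤ)}).primesOver (𝓞 M) :=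
      ⟨inferInstance, inferInstance⟩
    obtain ⟨h', hh'l, v₁, hv₁, 𝔓₁, h𝔓₁, hh'K⟩ := key (𝔔'.comap ιM) h𝔓'mem
    -- `σ|_M` is a Frobenius at `𝔔' ∩ M` relative to `K`, hence to `ℚ` (`N v' = l`); so is `h'|_ℚ`,
    -- and `l` is unramified in `M`: `σ|_M = h'`
    have hcard' : Nat.card (ℤ ⧸ (𝔔'.comap ιM).under ℤ) =
        Nat.card (𝓞 K ⧸ (𝔔'.comap ιM).under (𝓞 K)) := by
      rw [← Ideal.LiesOver.over (p := Ideal.span {(l : ℤ)}), natCard_int_quotient_span_natCast,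
        ← h𝔓'v'.2.over, hres v' hv' 𝔔' h𝔔']
    have hrσ : IsArithFrobAt (𝓞 K) (r σ) (𝔔'.comap ιM) := isArithFrobAt_absRestrictNormalHom M hσ
    have hrσZ : IsArithFrobAt ℤ ((r σ).restrictScalars ℚ) (𝔔'.comap ιM) :=
      (isArithFrobAt_restrictScalars_iff (r σ) hcard').mpr hrσ
    have heq : (r σ).restrictScalars ℚ = h'.restrictScalars ℚ := by
      have h1 := hrσZ.mul_inv_mem_inertia hh'l
      rw [NumberFields.inertia_eq_bot_of_isUnramifiedIn_span hunrM h𝔓'mem, Subgroup.mem_bot] at h1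
      exact mul_inv_eq_one.mp h1
    have heq' : r σ = h' := AlgEquiv.restrictScalars_injective ℚ heq
    obtain ⟨𝔔₁, h𝔔₁, σ₁, hσ₁, hτ⟩ := exists_isArithFrobAt_apply_eq_of_absRestrictNormalHom_eq M τ hker
      (hunr₀ v₁ hv₁) h𝔓₁ hh'K heq'
    exact ⟨v₁, hv₁, 𝔔₁, h𝔔₁, σ₁, hσ₁, hτ⟩

end KeyStep

/-! ## §5. The Chebotarev transfer (representation-free form of Lemma 4.3.2) -/

section Main

variable {K : Type} [Field K] [NumberField K]

omit [NumberField K] in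
/-- Infinitely many finite places have infinitely many norms (each fibre `{v | N v = n}` is
contained in the finite set of prime factors of `(n)`). [folklore] -/
theorem infinite_image_absNorm [NumberField K] {S : Set (HeightOneSpectrum (𝓞 K))}
    (hS : S.Infinite) : ((fun v : HeightOneSpectrum (𝓞 K) => Ideal.absNorm v.asIdeal) '' S).Infinite := by
  intro hfin
  apply hS
  refine (hfin.biUnion (t := fun n => {v : HeightOneSpectrum (𝓞 K) | Ideal.absNorm v.asIdeal = n})
    fun n hn => ?_).subset fun v hv => Set.mem_biUnion (Set.mem_image_of_mem _ hv) rfl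
  obtain ⟨v, -, rfl⟩ := hn
  have hn0 : Ideal.absNorm v.asIdeal ≠ 0 := by
    rw [ne_eq, Ideal.absNorm_eq_zero_iff]
    exact v.ne_bot
  have h : Ideal.span {((Ideal.absNorm v.asIdeal : ℕ) : 𝓞 K)} ≠ ⊥ := by
    rw [ne_eq, Ideal.span_singleton_eq_bot]
    exact_mod_cast hn0
  refine (Ideal.finite_factors h).subset fun w hw => ?_
  simp only [Set.mem_setOf_eq] at hw ⊢
  refine Ideal.dvd_iff_le.mpr ((Ideal.span_singleton_le_iff_mem _).mpr ?_)
  rw [← hw]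
  exact Ideal.absNorm_mem w.asIdeal

/-- **The Chebotarev transfer behind ACC+ Lemma 4.3.2** (representation-free).  Let
`τ : Γ_K → H` be a homomorphism with open kernel, `p₀` a prime which splits completely in `K` and
above which `τ` is unramified (`τ(I_𝔔) = 1` for every prime `𝔔` of `\bar ℤ_K` above every
`v ∣ p₀`), and `N ≥ 1` with `p₀ ∤ N`.  Then there are infinitely many primes `l` with `l ∤ N`,
`l ≡ p₀ (mod N)`, `l` completely split in `K`, `τ` unramified above `l`, and such that for every
place `v ∣ l`, every prime `𝔔 ∣ v` of `\bar ℤ_K` and every arithmetic Frobenius `σ ∈ Γ_K` at `𝔔`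
there are `v₁ ∣ p₀`, `𝔔₁ ∣ v₁` and an arithmetic Frobenius `σ₁` at `𝔔₁` with `τ(σ) = τ(σ₁)` — "any
other prime `l` which is unramified in `K'` and such that `Frob_l`, `Frob_{p₀}` lie in the same
conjugacy class of `Gal(K'/ℚ)` …; there are infinitely many such primes, by the Chebotarev density
theorem" (loc. cit.), for `K'` the Galois closure over `ℚ` of `K̄^{ker τ}(ζ_N)` and read through
`τ` at all places above `l`.  Proof: module docstring (§4 for a Chebotarev place `v` supplied by
`infinite_setOf_prime_absNorm_frobenius_restrict_eq`, after discarding the finitely many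
`l ∣ N · disc K`). [cite: ACCGHLNSTT2023, Lemma 4.3.2 (proof)]
[cite: NeukirchANT1999, Ch. VII Thm. (13.4)] -/
theorem infinite_setOf_splitsCompletely_frobenius_transfer {H : Type*} [Group H]
    (τ : absoluteGaloisGroup K →* H) (hτ : IsOpen (τ.ker : Set (absoluteGaloisGroup K)))
    {p₀ : ℕ} (hp₀ : p₀.Prime) (hsplit : SplitsCompletely K p₀)
    (hunr₀ : ∀ v : HeightOneSpectrum (𝓞 K), ((p₀ : ℕ) : 𝓞 K) ∈ v.asIdeal →
      ∀ 𝔔 ∈ v.primesAbove, ∀ g ∈ 𝔔.inertia (absoluteGaloisGroup K), τ g = 1)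
    {N : ℕ} (hN : 0 < N) (hpN : ¬ p₀ ∣ N) :
    {l : ℕ | l.Prime ∧ ¬ l ∣ N ∧ l ≡ p₀ [MOD N] ∧ SplitsCompletely K l ∧
      ∀ v : HeightOneSpectrum (𝓞 K), ((l : ℕ) : 𝓞 K) ∈ v.asIdeal →
        (∀ 𝔔 ∈ v.primesAbove, ∀ g ∈ 𝔔.inertia (absoluteGaloisGroup K), τ g = 1) ∧
        ∀ 𝔔 ∈ v.primesAbove, ∀ σ : absoluteGaloisGroup K, IsArithFrobAt (𝓞 K) σ 𝔔 →
          ∃ v₁ : HeightOneSpectrum (𝓞 K), ((p₀ : ℕ) : 𝓞 K) ∈ v₁.asIdeal ∧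
            ∃ 𝔔₁ ∈ v₁.primesAbove, ∃ σ₁ : absoluteGaloisGroup K,
              IsArithFrobAt (𝓞 K) σ₁ 𝔔₁ ∧ τ σ = τ σ₁}.Infinite := by
  classical
  -- coercions `((aeval x q : S) : K̄) = aeval (x : K̄) q` for subfields `S ⊆ K̄`
  have hcoe : ∀ (S : IntermediateField K (AlgebraicClosure K)) (x : S) (q : ℚ[X]),
      ((aeval x q : S) : AlgebraicClosure K) = aeval (x : AlgebraicClosure K) q :=
    fun S x q => (Polynomial.aeval_algebraMap_apply (AlgebraicClosure K) x q).symm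
  -- Step 1: `K₁ = K̄^{ker τ}`, finite over `K`, and a primitive element `θ` of `K₁/ℚ`
  set K₁ : IntermediateField K (AlgebraicClosure K) := IntermediateField.fixedField τ.ker with hK₁def
  haveI : FiniteDimensional K K₁ := finiteDimensional_fixedField_of_isOpen τ.ker hτ
  have hK₁fix : K₁.fixingSubgroup = τ.ker := fixingSubgroup_fixedField_of_isOpen τ.ker hτ
  haveI : FiniteDimensional ℚ K₁ := Module.Finite.trans K K₁
  obtain ⟨θ, hθ⟩ := Field.exists_primitive_element ℚ K₁
  have hK₁θ : ∀ y : K₁, ∃ q : ℚ[X], y = aeval θ q := by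
    intro y
    have hy : y ∈ (⊤ : IntermediateField ℚ K₁) := IntermediateField.mem_top
    rw [← hθ, ← IntermediateField.mem_toSubalgebra,
      IntermediateField.adjoin_simple_toSubalgebra_of_isAlgebraic
        (Algebra.IsAlgebraic.isAlgebraic θ),
      Algebra.adjoin_singleton_eq_range_aeval] at hy
    obtain ⟨q, hq⟩ := hy
    exact ⟨q, hq.symm⟩
  -- Step 2: a primitive `N`-th root of unity `ζ ∈ K̄`
  haveI : NeZero (N : AlgebraicClosure K) := ⟨by exact_mod_cast hN.ne'⟩
  obtain ⟨ζ, hζ⟩ := HasEnoughRootsOfUnity.exists_primitiveRoot (AlgebraicClosure K) N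
  -- Step 3: `M = K(roots of f)`, `f = minpoly_ℚ(θ) · (X^N - 1)`, finite Galois over `K`
  set f : ℚ[X] := minpoly ℚ θ * (X ^ N - C 1) with hfdef
  have hf0 : f ≠ 0 :=
    mul_ne_zero (minpoly.ne_zero (Algebra.IsIntegral.isIntegral θ)) (X_pow_sub_C_ne_zero hN 1)
  set fK : K[X] := f.map (algebraMap ℚ K) with hfKdef
  have hfK0 : fK ≠ 0 := (Polynomial.map_ne_zero_iff (algebraMap ℚ K).injective).mpr hf0
  set M : IntermediateField K (AlgebraicClosure K) :=
    IntermediateField.adjoin K (fK.rootSet (AlgebraicClosure K)) with hMdef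
  haveI hsf : IsSplittingField K M fK :=
    IntermediateField.adjoin_rootSet_isSplittingField (IsAlgClosed.splits _)
  haveI : Normal K M := Normal.of_isSplittingField fK
  haveI : FiniteDimensional K M := Polynomial.IsSplittingField.finiteDimensional M fK
  haveI : IsGalois K M := isGalois_iff.mpr ⟨inferInstance, inferInstance⟩
  haveI : NumberField M := NumberField.of_module_finite K M
  have hmemM : ∀ x : AlgebraicClosure K, aeval x f = 0 → x ∈ M := by
    intro x hx
    apply IntermediateField.subset_adjoin
    rw [Polynomial.mem_rootSet, Polynomial.aeval_map_algebraMap]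
    exact ⟨hfK0, hx⟩
  have hθf : aeval ((θ : K₁) : AlgebraicClosure K) f = 0 := by
    rw [hfdef, map_mul, ← hcoe, minpoly.aeval, ZeroMemClass.coe_zero, zero_mul]
  have hθM : ((θ : K₁) : AlgebraicClosure K) ∈ M := hmemM _ hθf
  have hζf : aeval ζ f = 0 := by
    rw [hfdef, map_mul, map_sub, aeval_X_pow, aeval_C, map_one, hζ.pow_eq_one, sub_self, mul_zero]
  have hζM : ζ ∈ M := hmemM ζ hζf
  -- `K₁ ⊆ M` (`K₁ = ℚ(θ)` and `θ ∈ M`)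
  set θM : M := ⟨((θ : K₁) : AlgebraicClosure K), hθM⟩ with hθMdef
  have hK₁M : K₁ ≤ M := by
    intro x hx
    obtain ⟨q, hq⟩ := hK₁θ ⟨x, hx⟩
    have hx' : x = aeval ((θ : K₁) : AlgebraicClosure K) q := by
      rw [← hcoe, ← hq]
    rw [hx', show ((θ : K₁) : AlgebraicClosure K) = ((θM : M) : AlgebraicClosure K) from rfl,
      ← hcoe]
    exact SetLike.coe_mem _
  -- `Gal(K̄/M) ≤ ker τ`
  have hr : ∀ (γ : absoluteGaloisGroup K) (x : M),
      ((absRestrictNormalHom M γ x : M) : AlgebraicClosure K) = γ • (x : AlgebraicClosure K) :=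
    fun γ x => AlgEquiv.restrictNormalHom_apply M _ x
  have hker : ∀ γ, absRestrictNormalHom M γ = 1 → τ γ = 1 := by
    intro γ hγ
    have hγM : γ ∈ (M.fixingSubgroup : Subgroup (absoluteGaloisGroup K)) := by
      rw [mem_fixingSubgroup_iff_forall_smul]
      intro x
      rw [← hr γ x, hγ, AlgEquiv.one_apply]
    have hγK₁ : γ ∈ (K₁.fixingSubgroup : Subgroup (absoluteGaloisGroup K)) :=
      IntermediateField.fixingSubgroup_antitone hK₁M hγM
    rw [hK₁fix] at hγK₁
    exact hγK₁
  -- Step 4: `M/ℚ` is Galois (`M` is a splitting field of `f` over `ℚ` as `K ⊆ ℚ(θ)`)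
  haveI : IsScalarTower ℚ K M := IsScalarTower.of_algebraMap_eq' (Subsingleton.elim _ _)
  have hsplitsQ : (f.map (algebraMap ℚ M)).Splits := by
    have h1 := hsf.splits
    rwa [hfKdef, Polynomial.map_map, ← IsScalarTower.algebraMap_eq ℚ K M] at h1
  have hrootiff : ∀ x : M, x ∈ fK.rootSet M ↔ x ∈ f.rootSet M := by
    intro x
    rw [Polynomial.mem_rootSet, Polynomial.mem_rootSet, Polynomial.aeval_map_algebraMap]
    exact ⟨fun h => ⟨hf0, h.2⟩, fun h => ⟨hfK0, h.2⟩⟩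
  have hθroot : θM ∈ f.rootSet M := by
    rw [Polynomial.mem_rootSet]
    refine ⟨hf0, ?_⟩
    have h1 : algebraMap M (AlgebraicClosure K) (aeval θM f) = 0 := by
      rw [← Polynomial.aeval_algebraMap_apply]
      exact hθf
    exact (map_eq_zero_iff _ (algebraMap M (AlgebraicClosure K)).injective).mp h1
  have hadjQ : Algebra.adjoin ℚ (f.rootSet M) = ⊤ := by
    set A : Subalgebra ℚ M := Algebra.adjoin ℚ (f.rootSet M) with hAdef
    have hKA : ∀ k : K, algebraMap K M k ∈ A := by
      intro k
      obtain ⟨q, hq⟩ := hK₁θ (algebraMap K K₁ k)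
      have h1 : algebraMap K M k = aeval θM q := by
        apply Subtype.ext
        change algebraMap K (AlgebraicClosure K) k = ((aeval θM q : M) : AlgebraicClosure K)
        rw [hcoe, IsScalarTower.algebraMap_apply K K₁ (AlgebraicClosure K) k,
          show algebraMap K₁ (AlgebraicClosure K) (algebraMap K K₁ k) =
            ((algebraMap K K₁ k : K₁) : AlgebraicClosure K) from rfl, hq, hcoe]
      rw [h1]
      exact Algebra.adjoin_mono (Set.singleton_subset_iff.mpr hθroot)
        (Polynomial.aeval_mem_adjoin_singleton ℚ θM)
    let A' : Subalgebra K M :=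
      { carrier := A
        mul_mem' := fun ha hb => A.mul_mem ha hb
        one_mem' := A.one_mem
        add_mem' := fun ha hb => A.add_mem ha hb
        zero_mem' := A.zero_mem
        algebraMap_mem' := hKA }
    have hA' : Algebra.adjoin K (fK.rootSet M) ≤ A' :=
      Algebra.adjoin_le fun x hx => (Algebra.subset_adjoin ((hrootiff x).mp hx) : x ∈ A)
    have htop : Algebra.adjoin K (fK.rootSet M) = ⊤ := hsf.adjoin_rootSet
    rw [eq_top_iff]
    intro x _
    have hx : x ∈ Algebra.adjoin K (fK.rootSet M) := by rw [htop]; exact Algebra.mem_top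
    exact hA' hx
  haveI : IsSplittingField ℚ M f := ⟨hsplitsQ, hadjQ⟩
  haveI : Normal ℚ M := Normal.of_isSplittingField f
  haveI : IsGalois ℚ M := isGalois_iff.mpr ⟨inferInstance, inferInstance⟩
  -- Step 5: `ζ` as an element of `𝓞 M`
  set ζM : M := ⟨ζ, hζM⟩ with hζMdef
  have hζM' : IsPrimitiveRoot ζM N := IsPrimitiveRoot.coe_submonoidClass_iff.mp hζ
  set ζO : 𝓞 M := ⟨ζM, hζM'.isIntegral hN⟩ with hζOdef
  have hζO : IsPrimitiveRoot ζO N := IsPrimitiveRoot.coe_submonoidClass_iff.mp hζM'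
  -- Step 6: a place `v₀ ∣ p₀`, a prime `𝔔₀ ∣ v₀` of `\bar ℤ_K` and an absolute Frobenius `σ₀` there
  have hp0 : Ideal.span {(p₀ : ℤ)} ≠ ⊥ := by
    rw [ne_eq, Ideal.span_singleton_eq_bot]; exact_mod_cast hp₀.ne_zero
  haveI hp0max : (Ideal.span {(p₀ : ℤ)}).IsMaximal :=
    ((Ideal.span_singleton_prime (by exact_mod_cast hp₀.ne_zero)).mpr
      (Nat.prime_iff_prime_int.mp hp₀)).isMaximal hp0
  haveI : FaithfulSMul ℤ (𝓞 K) :=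
    (faithfulSMul_iff_algebraMap_injective ℤ (𝓞 K)).mpr (algebraMap ℤ (𝓞 K)).injective_int
  obtain ⟨P₀, hP₀max, hP₀over⟩ :=
    Ideal.exists_maximal_ideal_liesOver_of_isIntegral (S := 𝓞 K) (Ideal.span {(p₀ : ℤ)})
  haveI := hP₀over
  have hP₀ne : P₀ ≠ ⊥ := Ideal.ne_bot_of_liesOver_of_ne_bot hp0 P₀
  set v₀ : HeightOneSpectrum (𝓞 K) := ⟨P₀, hP₀max.isPrime, hP₀ne⟩ with hv₀def
  have hv₀ : ((p₀ : ℕ) : 𝓞 K) ∈ v₀.asIdeal := natCast_mem_of_liesOver_span hP₀over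
  obtain ⟨𝔔₀, h𝔔₀⟩ := primesAbove_nonempty v₀
  obtain ⟨σ₀, hσ₀⟩ := exists_isArithFrobAt_of_mem_primesAbove_holds h𝔔₀
  -- Step 7: Chebotarev for `M/K` and the class of `σ₀`; discard `l ∣ N` and `l ∣ disc K`
  have hS := infinite_setOf_prime_absNorm_frobenius_restrict_eq M σ₀
  have hbad : ({l : ℕ | l ∣ N} ∪ {l : ℕ | (l : ℤ) ∣ NumberField.discr K}).Finite := by
    refine Set.Finite.union ?_ ?_
    · exact (Set.finite_le_nat N).subset fun l hl => Nat.le_of_dvd hN hl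
    · refine (Set.finite_le_nat (NumberField.discr K).natAbs).subset fun l hl => ?_
      exact Nat.le_of_dvd (Int.natAbs_pos.mpr (NumberField.discr_ne_zero K))
        (Int.natCast_dvd.mp hl)
  refine ((infinite_image_absNorm hS).sdiff hbad).mono ?_
  rintro l ⟨⟨v, ⟨hprime, hunrv, 𝔔, h𝔔, Φ, hΦ, hΦσ₀⟩, rfl⟩, hl⟩
  simp only [Set.mem_union, Set.mem_setOf_eq, not_or] at hl
  obtain ⟨hlN, hldisc⟩ := hl
  have hunrK : Algebra.IsUnramifiedIn (𝓞 K) (Ideal.span {((Ideal.absNorm v.asIdeal : ℕ) : ℤ)}) :=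
    (NumberField.not_dvd_discr_iff_isUnramifiedIn K (𝓞 K)
      (Nat.prime_iff_prime_int.mp hprime)).mp hldisc
  obtain ⟨hmod, hsplitl, hrest⟩ := modEq_and_splitsCompletely_and_frobenius_transfer M τ hker hp₀
    hsplit hunr₀ hN hpN hζO hv₀ h𝔔₀ hσ₀ hprime hlN hunrK rfl hunrv h𝔔 hΦ hΦσ₀
  exact ⟨hprime, hlN, hmod, hsplitl, hrest⟩

end Main

/-! ## §6. ACC+ Lemma 4.3.2 and the choice of `p₀` in the proof of Thm. 6.1.1 -/

section Lemma432

variable {K : Type} [Field K] [NumberField K] {k : Type*} [Field k] {n : ℕ}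
  {τ : absoluteGaloisGroup K →* GL (Fin n) k}

/-- **ACC+ Lemma 4.3.2: a decomposed generic representation has infinitely many decomposed
generic primes.**  Let `k` be a field of prime characteristic `ℓ` and `τ : Γ_K → GL_n(k)` a
homomorphism with open kernel (a continuous representation; for the residual representation of a
`p`-adic Galois representation see `FramedGaloisRep.isOpen_ker_of_isResidualRepOf`).  If some prime
`p₀ ≠ ℓ` is decomposed generic for `τ` (Def. 4.3.1: `p₀` splits completely in `K` and `τ` is
generic at every `v ∣ p₀`), then infinitely many primes are.  Indeed the primes `l` of
`infinite_setOf_splitsCompletely_frobenius_transfer` (with `N = ℓ`) are completely split, `τ` is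
unramified above them, and at every `𝔔 ∣ v ∣ l` every Frobenius value `τ(σ)` is a Frobenius value
`τ(σ₁)` above `p₀`, whose eigenvalues satisfy `α_i/α_j ∉ {1, p₀}`; as `l ≡ p₀ (mod ℓ)`, `q_v = l`
and `q_{v₁} = p₀` agree in `k̄`. [cite: ACCGHLNSTT2023, Lemma 4.3.2] -/
theorem IsDecomposedGeneric.infinite_setOf_isDecomposedGenericPrime {ℓ : ℕ} [Fact ℓ.Prime]
    [CharP k ℓ] (hτ : IsOpen (τ.ker : Set (absoluteGaloisGroup K))) (h : IsDecomposedGeneric τ) :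
    {p : ℕ | IsDecomposedGenericPrime τ p}.Infinite := by
  have hℓ : ℓ.Prime := Fact.out
  have hchar : ringChar k = ℓ := ringChar.eq k ℓ
  obtain ⟨p₀, hp₀, hp₀ℓ, hsplit, hgen⟩ := h
  rw [hchar] at hp₀ℓ
  have hunr₀ : ∀ v : HeightOneSpectrum (𝓞 K), ((p₀ : ℕ) : 𝓞 K) ∈ v.asIdeal →
      ∀ 𝔔 ∈ v.primesAbove, ∀ g ∈ 𝔔.inertia (absoluteGaloisGroup K), τ g = 1 :=
    fun v hv 𝔔 h𝔔 g hg => (hgen v hv).1 𝔔 h𝔔 g hg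
  have hpℓ : ¬ p₀ ∣ ℓ := fun hd => hp₀ℓ ((Nat.prime_dvd_prime_iff_eq hp₀ hℓ).mp hd)
  haveI : CharP (AlgebraicClosure k) ℓ :=
    charP_of_injective_algebraMap (algebraMap k (AlgebraicClosure k)).injective ℓ
  refine (infinite_setOf_splitsCompletely_frobenius_transfer τ hτ hp₀ hsplit hunr₀ hℓ.pos hpℓ).mono
    ?_
  rintro l ⟨hl, hlℓ, hmod, hsplitl, hrest⟩
  refine ⟨hl, ?_, hsplitl, fun v hv => ⟨(hrest v hv).1, fun 𝔔 h𝔔 σ hσ => ?_⟩⟩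
  · rw [hchar]
    rintro rfl
    exact hlℓ dvd_rfl
  · obtain ⟨v₁, hv₁, 𝔔₁, h𝔔₁, σ₁, hσ₁, hτσ⟩ := (hrest v hv).2 𝔔 h𝔔 σ hσ
    obtain ⟨hnodup, hratio⟩ := (hgen v₁ hv₁).2 𝔔₁ h𝔔₁ σ₁ hσ₁
    have hq : (v.residueCard : AlgebraicClosure k) = (v₁.residueCard : AlgebraicClosure k) := by
      rw [hsplitl.2 v hv, hsplit.2 v₁ hv₁]
      exact (CharP.natCast_eq_natCast (AlgebraicClosure k) ℓ).mpr hmod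
    rw [hτσ, hq]
    exact ⟨hnodup, hratio⟩

/-- **The choice of `p₀` and `V₂` in the proof of ACC+ Thm. 6.1.1** (§6.5.12, p. 88: "There
exists a rational prime `p₀ ≠ p` which is decomposed generic for `ρ̄`, and `V₂` is equal to the
set of `p₀`-adic places of `F`.  For each `v ∈ V₀ ∪ V₁ ∪ V₂`, `v ∤ 2`, `v ∤ p`, and `ρ` and `π` are
both unramified at `v`"): a decomposed generic `τ` with open kernel admits a decomposed generic
prime outside any finite set `T` of primes (e.g. `{2, p}`) and below no place of any finite set `S`
of finite places of `K` (e.g. the places where `ρ` or `π` ramifies), by Lemma 4.3.2.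
[cite: ACCGHLNSTT2023, §6.5.12 (proof of Thm. 6.1.1, choice of `V₂`)] -/
theorem IsDecomposedGeneric.exists_isDecomposedGenericPrime_forall_not_mem {ℓ : ℕ} [Fact ℓ.Prime]
    [CharP k ℓ] (hτ : IsOpen (τ.ker : Set (absoluteGaloisGroup K))) (h : IsDecomposedGeneric τ)
    {S : Set (HeightOneSpectrum (𝓞 K))} (hS : S.Finite) {T : Set ℕ} (hT : T.Finite) :
    ∃ p₀ : ℕ, p₀ ∉ T ∧ IsDecomposedGenericPrime τ p₀ ∧ ∀ v ∈ S, ((p₀ : ℕ) : 𝓞 K) ∉ v.asIdeal := by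
  -- each place contains at most one rational prime
  have hsub : ∀ v : HeightOneSpectrum (𝓞 K),
      ({p : ℕ | p.Prime ∧ ((p : ℕ) : 𝓞 K) ∈ v.asIdeal} : Set ℕ).Subsingleton := by
    rintro v p ⟨hp, hpv⟩ q ⟨hq, hqv⟩
    by_contra hne
    have hcop : IsCoprime (p : ℤ) (q : ℤ) :=
      Nat.isCoprime_iff_coprime.mpr ((Nat.coprime_primes hp hq).mpr hne)
    obtain ⟨a, b, hab⟩ := hcop
    apply v.isPrime.ne_top
    rw [Ideal.eq_top_iff_one]
    have h1 : ((a * p + b * q : ℤ) : 𝓞 K) = 1 := by rw [hab, Int.cast_one]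
    rw [← h1]
    push_cast
    exact v.asIdeal.add_mem (v.asIdeal.mul_mem_left _ hpv) (v.asIdeal.mul_mem_left _ hqv)
  have hB : (T ∪ ⋃ v ∈ S, {p : ℕ | p.Prime ∧ ((p : ℕ) : 𝓞 K) ∈ v.asIdeal}).Finite :=
    hT.union (hS.biUnion fun v _ => (hsub v).finite)
  obtain ⟨p₀, hp₀mem, hp₀B⟩ := ((h.infinite_setOf_isDecomposedGenericPrime hτ).sdiff hB).nonempty
  simp only [Set.mem_union, Set.mem_iUnion, Set.mem_setOf_eq, not_or, not_exists, not_and] at hp₀B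
  exact ⟨p₀, hp₀B.1, hp₀mem, fun v hv hpv => hp₀B.2 v hv hp₀mem.1 hpv⟩

end Lemma432


end Literature.NumberTheory.GaloisRepresentations

end
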